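import Mathlib.LinearAlgebra.Matrix.Transvection
import Mathlib.RingTheory.MvPolynomial.WeightedHomogeneous
import Mathlib.Algebra.MonoidAlgebra.MapDomain
import Mathlib.Logic.Equiv.Fin.Basic
import Literature.Computability.AlgebraicComplexity.OrbitCoordinateRing
import Literature.RepresentationTheory.GeneralLinear.HyperalgebraCoinvariants
import HarnessLib

/-!
# The hyperalgebra of `GL_σ` on the coordinate ring of `Sym^m`, the integral lattice of an
# orbit closure, and its torsion ranks `d_p(f; λ)`

Topic `Literature/RepresentationTheory/GeneralLinear`; the INSTANCE part of definition request
`defn-hyperalgebraCoinvariants` (route ValiantsHypothesis/IntegralGCT, crux CoinvariantTorsionFlip):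
the abstract layer is `HyperalgebraCoinvariants.lean` (`KostantModule`, `Coinvariants`,
`hyperalgebraCoinvariants`, `torsionRank`).

## Mathematics

Let `V = Sym^m(R^σ)` with coordinates the coefficients at the degree-`m` monomials
`d ∈ DegIdx σ m`, so `R[V] = MvPolynomial (DegIdx σ m) R`, with `GL_σ(R)` acting by
`(g · F)(v) = F(g⁻¹ v)` (`coordSubst m g`, `coordRep`, file `OrbitCoordinateRing.lean`; any
commutative ring `R`). For `i ≠ j` the elementary unipotent `u_ij(t) = 1 + t E_ij ∈ GL_σ(R[t])`
is a one-parameter subgroup, and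
`u_ij(t) · F = Σ_k t^k (E_ij^(k) · F)` DEFINES `R`-linear operators `E_ij^(k)` on `R[V]`
(`coordDivPow m i j k F` = the `t^k`-coefficient of `coordSubst m (u_ij(t)) F`). This is the
action of the divided powers `E_ij^(k) = E_ij^k/k! ∈ Dist(GL_σ, ℤ) = U_ℤ(gl_σ)` (the image of the
distribution `γ_k ∈ Dist(G_a)`, dual to `t^k`, under `u_ij`; Jantzen 2003 I.7.8, I.7.11–12,
II.1.12); over `ℚ ⊆ R` it is `(dρ(E_ij))^k / k!` for the differential `dρ` of `coordRep`, since
`ρ(exp(t E_ij)) = exp(t dρ(E_ij))`. On generators: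
`E_ij^(k) X_d = (-1)^k binom(d_j + k, k) X_{d - k ε_i + k ε_j}` (`0` if `d_i < k`), visibly
integral — `ℤ[V] = Sym(Sym^m(ℤ^σ)^∨)` is `U_ℤ`-stable (Akin–Buchsbaum–Weyman 1982: `Sym^d` and
its dual `D^d` are `GL`-modules over `ℤ`). The diagonal torus acts on `X_d` by `s^{-d}`, so
`X_d` has weight `-d ∈ ℤ^σ` and a monomial `Π X_d^{n_d}` has weight `-Σ n_d d`
(`coordWeight`, `coordWeightSpace` = Mathlib's weighted-homogeneous submodules); `E_ij`
shifts weights by `ε_i - ε_j`, and `E_ij`, `i > j`, are the lowering operators. NB: all weights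
of `R[V]_d` (degree-`d` coordinate forms) are `≤ 0` with coordinate sum `-m·d`; the weight
determines the degree.

`E_ij^(k)` preserves the degree of coordinate forms (`isHomogeneous_coordDivPow`), so each
`R[V]_d = Sym^d(Sym^m(R^σ)^∨)` is a Kostant module (`coordKostantModuleDeg`).

For a form `f` over a field `k` (e.g. `det_m`, padded `per_n` over `ℂ`), the degree-`d` INTEGRAL
LATTICE of `k[Δ f] = k[V] ⧸ I(GL·f)` is `Λ(f,d) = {classes of integer degree-d coordinate forms}`
(`orbitIntLatticeDeg`; `coe_orbitIntLatticeDeg` is the set written in the route's cruxes)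
`≅ Λ_{f,d} = ℤ[V]_d ⧸ K_{f,d}`, `K_f = {F ∈ ℤ[V] : F ∈ I(GL·f)}` (`orbitLatticeKer`,
`orbitLatticeKerDeg`, `OrbitLatticeDeg`). The route's certificate is
`d_p(f; d, λ) = dim_{𝔽_p} 𝔽_p ⊗ Coinv(Λ_{f,d})_λ`, `Coinv(Λ) = Λ ⧸ Σ_{i>j, l≥1} E_ij^(l) Λ`
(`orbitTorsionRank f m d p λ`, defined through `KostantModule.presentedTorsionRank` of
`coordKostantModuleDeg σ ℤ m d` and `K_{f,d}` — no stability hypothesis is needed to STATE it;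
that `K_{f,d}` IS stable, so that `Λ_{f,d}` is a quotient `KostantModule` whose `torsionRank` is
`orbitTorsionRank` (`KostantModule.presentedTorsionRank_eq`), follows from the
`GL(k)`-stability of `I(GL·f)` by a Vandermonde argument over the infinite field `k`: sequel
`OrbitLatticeStability.lean`). For matrix-shaped variables `σ = Fin m × Fin m` (no
`LinearOrder` instance) the Borel is fixed by the row-major order (`rowMajorLinearOrder`,
`matrixOrbitTorsionRank`).

## Sources

* J. C. Jantzen, *Representations of Algebraic Groups*, 2nd ed., AMS (2003), I.7.8–7.12,
  II.1.12 (distribution algebras; `Dist(G_a)`; `Dist(GL_n,ℤ)` = Kostant form; action on modules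
  via the comodule map).
* J. E. Humphreys, *Introduction to Lie Algebras and Representation Theory* (1972), §26.4,
  §27.1 (Kostant `ℤ`-form, admissible lattices).
* K. Akin, D. A. Buchsbaum, J. Weyman, Adv. Math. 44 (1982) (Schur functors over `ℤ`).
* K. Mulmuley, M. Sohoni, SIAM J. Comput. 31 (2001), §4–5 (`k[Δ f]` as a `GL`-module).

## Design / not here

* Everything about `R[V]` is over an arbitrary commutative ring `R`; the lattice of a form needs
  a field `k` for `orbitVanishingIdeal`. `coordDivPow m i i k = 0` (junk; the torus acts through
  the grading). `p` in `d_p` is meant prime (`p = 0`: free rank; `p = 1`: junk `0`).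
* Not here: `coordDivPow m i j 0 = id` and `K_f` stable (sequel); `E_ij^(1) = dρ(E_ij)`, the
  binomial formula on generators, weight shifts, and the monotonicity of `d_p` along
  lattice-preserving intertwiners (abstractly `KostantModule.torsionRank_le_of_surjective`).
-/

noncomputable section

open MvPolynomial
open scoped TensorProduct Polynomial

namespace Literature.RepresentationTheory.GeneralLinear

open Literature.Computability.AlgebraicComplexity

/-! ### `t^k`-coefficients of polynomial functions with coefficients in `R[t]` -/

section TCoeff

variable {ι : Type*} {R : Type*} [CommRing R]

/-- The `t^k`-coefficient of `P ∈ R[t][V]`, taken coefficientwise: `Σ_n (P_n)_k X^n`.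
[folklore] -/
def tCoeffFun (k : ℕ) (P : MvPolynomial ι R[X]) : MvPolynomial ι R :=
  AddMonoidAlgebra.map (Polynomial.lcoeff R k).toAddMonoidHom P

/-- Coefficients of `tCoeffFun`. [folklore] -/
@[simp] theorem coeff_tCoeffFun (k : ℕ) (P : MvPolynomial ι R[X]) (n : ι →₀ ℕ) :
    coeff n (tCoeffFun k P) = (coeff n P).coeff k :=
  rfl

/-- The `t^k`-coefficient map `R[t][V] → R[V]` as an `R`-linear map. [folklore] -/
def tCoeff (k : ℕ) : MvPolynomial ι R[X] →ₗ[R] MvPolynomial ι R where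
  toFun := tCoeffFun k
  map_add' P Q := by
    ext n
    simp only [coeff_tCoeffFun, coeff_add, Polynomial.coeff_add]
  map_smul' c P := by
    ext n
    simp only [coeff_tCoeffFun, coeff_smul, Polynomial.coeff_smul, RingHom.id_apply]

/-- Coefficients of `tCoeff`: `(tCoeff k P)_n = (P_n)_k`. [folklore] -/
@[simp] theorem coeff_tCoeff (k : ℕ) (P : MvPolynomial ι R[X]) (n : ι →₀ ℕ) :
    coeff n (tCoeff k P) = (coeff n P).coeff k :=
  rfl

/-- On constants in `t`: the `t^k`-coefficient of `F ⊗ 1 ∈ R[t][V]` is `F` for `k = 0` and `0`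
otherwise. [folklore] -/
theorem tCoeff_map_C (k : ℕ) (F : MvPolynomial ι R) :
    tCoeff k (map (Polynomial.C : R →+* R[X]) F) = if k = 0 then F else 0 := by
  ext n
  rw [coeff_tCoeff, coeff_map, Polynomial.coeff_C]
  split_ifs <;> simp

/-- `tCoeff` preserves homogeneity (it acts coefficientwise). [folklore] -/
theorem isHomogeneous_tCoeff {d : ℕ} {P : MvPolynomial ι R[X]} (hP : P.IsHomogeneous d)
    (l : ℕ) : (tCoeff l P).IsHomogeneous d := by
  intro n hn
  rw [coeff_tCoeff] at hn
  exact hP fun h0 => hn (by rw [h0, Polynomial.coeff_zero])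

end TCoeff

/-! ### Elementary unipotents and the divided-power operators `E_ij^(k)` on `R[Sym^m]` -/

section DivPow

variable {σ : Type*} [Fintype σ] [DecidableEq σ] {R : Type*} [CommRing R]

/-- The elementary unipotent (transvection) `u_ij(c) = 1 + c E_ij ∈ GL_σ(R)` for `i ≠ j`, with
inverse `u_ij(-c)`. [folklore] -/
def transvectionGL {i j : σ} (h : i ≠ j) (c : R) : GL σ R :=
  ⟨Matrix.transvection i j c, Matrix.transvection i j (-c),
    by rw [Matrix.transvection_mul_transvection_same _ _ h, add_neg_cancel,
      Matrix.transvection_zero],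
    by rw [Matrix.transvection_mul_transvection_same _ _ h, neg_add_cancel,
      Matrix.transvection_zero]⟩

/-- The matrix of `transvectionGL`. [folklore] -/
@[simp] theorem coe_transvectionGL {i j : σ} (h : i ≠ j) (c : R) :
    ((transvectionGL h c : GL σ R) : Matrix σ σ R) = Matrix.transvection i j c :=
  rfl

/-- `u_ij(c)⁻¹ = u_ij(-c)`. [folklore] -/
theorem transvectionGL_inv {i j : σ} (h : i ≠ j) (c : R) :
    (transvectionGL h c)⁻¹ = transvectionGL h (-c) :=
  Units.ext rfl

/-- **The divided-power operator `E_ij^(k)`** of the hyperalgebra `Dist(GL_σ) = U_ℤ(gl_σ)` acting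
on the coordinate ring `R[Sym^m] = MvPolynomial (DegIdx σ m) R`: the `t^k`-coefficient of the
action `coordSubst m (u_ij(t))` of the generic elementary unipotent `u_ij(t) = 1 + t E_ij ∈
GL_σ(R[t])` on `F ⊗ 1`, i.e. `u_ij(t) · F = Σ_k t^k E_ij^(k) F`. Over `ℚ ⊆ R` this is
`dρ(E_ij)^k / k!` for the differential `dρ` of `coordRep`. Junk value `0` for `i = j` (the
torus acts through the weight grading `coordWeightSpace`). [cite: Jantzen2003, I.7.8 and II.1.12] -/
def coordDivPow (m : ℕ) (i j : σ) (k : ℕ) :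
    MvPolynomial (DegIdx σ m) R →ₗ[R] MvPolynomial (DegIdx σ m) R :=
  if h : i = j then 0 else
    tCoeff k ∘ₗ
      ((coordSubst m (transvectionGL h (Polynomial.X : R[X]))).toLinearMap.restrictScalars R)
      ∘ₗ (mapAlgHom (Algebra.ofId R R[X]) :
          MvPolynomial (DegIdx σ m) R →ₐ[R] MvPolynomial (DegIdx σ m) R[X]).toLinearMap

/-- Unfolding `coordDivPow` for `i ≠ j`. [folklore] -/
theorem coordDivPow_apply (m : ℕ) {i j : σ} (h : i ≠ j) (k : ℕ) (F : MvPolynomial (DegIdx σ m) R) :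
    coordDivPow m i j k F =
      tCoeff k (coordSubst m (transvectionGL h (Polynomial.X : R[X]))
        (map (algebraMap R R[X]) F)) := by
  rw [coordDivPow, dif_neg h]
  rfl

/-- The junk value at `i = j`. [folklore] -/
@[simp] theorem coordDivPow_self (m : ℕ) (i : σ) (k : ℕ) :
    (coordDivPow m i i k : MvPolynomial (DegIdx σ m) R →ₗ[R] _) = 0 :=
  dif_pos rfl

/-- The **weight** of the coordinate function `X_d` on `Sym^m`: the diagonal torus `diag(s)` acts
on `X_d` by `s^{-d}` (because `(g · F)(v) = F(g⁻¹ v)`), so `wt(X_d) = -d ∈ ℤ^σ`.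
[cite: MulmuleySohoni2001, §4–§5] -/
def coordWeight (m : ℕ) (d : DegIdx σ m) : σ → ℤ :=
  fun i => -((d.1 i : ℕ) : ℤ)

/-- Unfolding `coordWeight`. [folklore] -/
@[simp] theorem coordWeight_apply (m : ℕ) (d : DegIdx σ m) (i : σ) :
    coordWeight m d i = -((d.1 i : ℕ) : ℤ) := rfl

variable (R) in
/-- The **weight-`μ` component** `R[Sym^m]_μ`: polynomial functions all of whose monomials
`Π X_d^{n_d}` have weight `-Σ_d n_d d = μ` (Mathlib's weighted-homogeneous submodule for the
weight function `coordWeight`). [cite: Humphreys1972, §27.1 Theorem (a)] -/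
def coordWeightSpace (m : ℕ) (μ : σ → ℤ) : Submodule R (MvPolynomial (DegIdx σ m) R) :=
  weightedHomogeneousSubmodule R (coordWeight m) μ

/-- Membership in a weight component. [folklore] -/
theorem mem_coordWeightSpace_iff (m : ℕ) (μ : σ → ℤ) (F : MvPolynomial (DegIdx σ m) R) :
    F ∈ coordWeightSpace R m μ ↔ F.IsWeightedHomogeneous (coordWeight m) μ :=
  mem_weightedHomogeneousSubmodule R _ μ F

/-- A monomial `c · Π X_d^{n_d}` lies in the weight component `-Σ n_d d`. [folklore] -/
theorem monomial_mem_coordWeightSpace (m : ℕ) (n : DegIdx σ m →₀ ℕ) (c : R) :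
    monomial n c ∈ coordWeightSpace R m (Finsupp.weight (coordWeight m) n) :=
  (mem_coordWeightSpace_iff m _ _).2 (isWeightedHomogeneous_monomial _ n c rfl)

/-- `X_d` has weight `-d`. [folklore] -/
theorem X_mem_coordWeightSpace (m : ℕ) (d : DegIdx σ m) :
    (X d : MvPolynomial (DegIdx σ m) R) ∈ coordWeightSpace R m (coordWeight m d) :=
  (mem_coordWeightSpace_iff m _ _).2 (isWeightedHomogeneous_X R _ d)

variable (σ R) in
/-- **The coordinate ring `R[Sym^m(R^σ)]` as a Kostant module**: weight grading `coordWeightSpace`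
and divided-power operators `coordDivPow` (the hyperalgebra `Dist(GL_σ)` acting on
`Sym(Sym^m(R^σ)^∨)`, an admissible `ℤ`-form for `R = ℤ`).
[cite: Jantzen2003, I.7.8 and II.1.12] -/
def coordKostantModule (m : ℕ) : KostantModule R σ (MvPolynomial (DegIdx σ m) R) where
  weightSpace := coordWeightSpace R m
  divPow := coordDivPow m

/-- The weight components of `coordKostantModule`. [folklore] -/
@[simp] theorem coordKostantModule_weightSpace (m : ℕ) (μ : σ → ℤ) :
    (coordKostantModule σ R m).weightSpace μ = coordWeightSpace R m μ := rfl

/-- The operators of `coordKostantModule`. [folklore] -/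
@[simp] theorem coordKostantModule_divPow (m : ℕ) (i j : σ) (k : ℕ) :
    (coordKostantModule σ R m).divPow i j k = coordDivPow m i j k := rfl

/-- Linear substitution of coordinates preserves homogeneity, over any commutative ring
(the tree's `isHomogeneous_coordSubst` is the case of a field). [folklore] -/
theorem isHomogeneous_coordSubst' {m d : ℕ} (A : GL σ R) {F : MvPolynomial (DegIdx σ m) R}
    (hF : F.IsHomogeneous d) : (coordSubst m A F).IsHomogeneous d := by
  have hg : ∀ c : DegIdx σ m,
      (∑ e : DegIdx σ m, coeff c.1 (linSubstRep σ R A⁻¹ (monomial e.1 1)) •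
        (X e : MvPolynomial (DegIdx σ m) R)).IsHomogeneous 1 := fun c => by
    refine IsHomogeneous.sum _ _ 1 fun e _ => ?_
    rw [smul_eq_C_mul]
    exact (isHomogeneous_X R e).C_mul _
  have h := hF.aeval _ hg
  rwa [one_mul] at h

/-- **The divided powers act degree-wise**: `E_ij^(l)` maps degree-`d` coordinate forms to
degree-`d` coordinate forms. [folklore] -/
theorem isHomogeneous_coordDivPow (m : ℕ) (i j : σ) (l : ℕ) {d : ℕ}
    {F : MvPolynomial (DegIdx σ m) R} (hF : F.IsHomogeneous d) :
    (coordDivPow m i j l F).IsHomogeneous d := by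
  by_cases h : i = j
  · subst h
    rw [coordDivPow_self, LinearMap.zero_apply]
    exact isHomogeneous_zero _ _ d
  rw [coordDivPow_apply m h]
  exact isHomogeneous_tCoeff (isHomogeneous_coordSubst' _ (hF.map _)) l

/-- Each homogeneous piece `R[V]_d` is a stable submodule of `coordKostantModule`. [folklore] -/
theorem isStable_homogeneousSubmodule (m d : ℕ) :
    (coordKostantModule σ R m).IsStable (homogeneousSubmodule (DegIdx σ m) R d) :=
  fun i j l F hF => (mem_homogeneousSubmodule d _).2
    (isHomogeneous_coordDivPow m i j l ((mem_homogeneousSubmodule d F).1 hF))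

variable (σ R) in
/-- **The degree-`d` coordinate forms `R[Sym^m]_d = Sym^d(Sym^m(R^σ)^∨)` as a Kostant module**
(restriction of `coordKostantModule`; for `R = ℤ` the universal `ℤ`-form of the plethysm
`Sym^d (Sym^m)^∨`). [cite: AkinBuchsbaumWeyman1982, §II–III (Schur functors over ℤ)] -/
def coordKostantModuleDeg (m d : ℕ) :
    KostantModule R σ (homogeneousSubmodule (DegIdx σ m) R d) :=
  (coordKostantModule σ R m).restrict _ (isStable_homogeneousSubmodule m d)

end DivPow

/-! ### The integral lattice of the coordinate ring of an orbit closure -/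

section Lattice

variable {σ : Type*} [Fintype σ] [DecidableEq σ] {k : Type*} [Field k]

/-- The class in `k[Δ f] = k[V] ⧸ I(GL·f)` of an INTEGER coordinate form:
`F ↦ (F ⊗ 1) mod I(GL·f)`, a `ℤ`-algebra map `ℤ[V] → k[Δ f]`. [cite: MulmuleySohoni2001, §5] -/
def intClassMap (f : MvPolynomial σ k) (m : ℕ) :
    MvPolynomial (DegIdx σ m) ℤ →ₐ[ℤ] OrbitCoordRing f m :=
  (Ideal.Quotient.mkₐ ℤ (orbitVanishingIdeal f m)).comp (mapAlgHom (Algebra.ofId ℤ k))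

/-- Unfolding `intClassMap`. [folklore] -/
theorem intClassMap_apply (f : MvPolynomial σ k) (m : ℕ) (F : MvPolynomial (DegIdx σ m) ℤ) :
    intClassMap f m F =
      Ideal.Quotient.mk (orbitVanishingIdeal f m) (map (Int.castRingHom k) F) :=
  rfl

/-- `K_f`: integer coordinate forms vanishing on the orbit `GL(k) · f`, i.e. whose image in
`k[V]` lies in `I(GL·f)`; the kernel of `intClassMap`. [cite: MulmuleySohoni2001, §5] -/
def orbitLatticeKer (f : MvPolynomial σ k) (m : ℕ) : Submodule ℤ (MvPolynomial (DegIdx σ m) ℤ) :=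
  LinearMap.ker (intClassMap f m).toLinearMap

/-- Membership in `K_f`. [folklore] -/
theorem mem_orbitLatticeKer_iff (f : MvPolynomial σ k) (m : ℕ) (F : MvPolynomial (DegIdx σ m) ℤ) :
    F ∈ orbitLatticeKer f m ↔ map (Int.castRingHom k) F ∈ orbitVanishingIdeal f m := by
  rw [orbitLatticeKer, LinearMap.mem_ker, AlgHom.toLinearMap_apply, intClassMap_apply,
    Ideal.Quotient.eq_zero_iff_mem]

/-- The degree-`d` part `Λ(f,d)` of the integral lattice inside `k[Δ f]`: classes of integer
forms of degree `d` (the lattice of the route's cruxes `IntegralFlipQP`, `IntegralPrinciple`).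
[cite: MulmuleySohoni2001, §5] -/
def orbitIntLatticeDeg (f : MvPolynomial σ k) (m d : ℕ) : Submodule ℤ (OrbitCoordRing f m) :=
  (homogeneousSubmodule (DegIdx σ m) ℤ d).map (intClassMap f m).toLinearMap

/-- `Λ(f,d)` is literally the set of classes of integer homogeneous degree-`d` forms. [folklore] -/
theorem coe_orbitIntLatticeDeg (f : MvPolynomial σ k) (m d : ℕ) :
    (orbitIntLatticeDeg f m d : Set (OrbitCoordRing f m)) =
      {y | ∃ F : MvPolynomial (DegIdx σ m) ℤ, F.IsHomogeneous d ∧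
        Ideal.Quotient.mk (orbitVanishingIdeal f m) (map (Int.castRingHom k) F) = y} := by
  ext y
  simp only [orbitIntLatticeDeg, Submodule.map_coe, Set.mem_image, SetLike.mem_coe,
    mem_homogeneousSubmodule, Set.mem_setOf_eq]
  constructor <;> rintro ⟨F, hF, rfl⟩ <;> exact ⟨F, hF, rfl⟩

/-- `K_{f,d} = K_f ∩ ℤ[V]_d`, inside the degree-`d` integer coordinate forms.
[cite: MulmuleySohoni2001, §5] -/
def orbitLatticeKerDeg (f : MvPolynomial σ k) (m d : ℕ) :
    Submodule ℤ (homogeneousSubmodule (DegIdx σ m) ℤ d) :=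
  (orbitLatticeKer f m).comap (homogeneousSubmodule (DegIdx σ m) ℤ d).subtype

/-- **`Λ_{f,d}`**, the degree-`d` integral lattice of `k[Δ f]_d`, presented as `ℤ[V]_d ⧸ K_{f,d}`
(a finitely generated abelian group; `≅ Λ(f,d)`: `orbitLatticeDegEquiv` in the sequel).
[cite: MulmuleySohoni2001, §5] -/
abbrev OrbitLatticeDeg (f : MvPolynomial σ k) (m d : ℕ) : Type _ :=
  homogeneousSubmodule (DegIdx σ m) ℤ d ⧸ orbitLatticeKerDeg f m d

end Lattice

/-! ### The torsion ranks `d_p(f; λ)` -/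

section TorsionRank

variable {σ : Type*} [Fintype σ] [LinearOrder σ] {k : Type*} [Field k]

/-- `𝔽_p ⊗ Coinv(Λ_{f,d})_λ` (any coefficient ring `A` in place of `𝔽_p`): the weight-`λ`
lowering coinvariants of the degree-`d` integral lattice of `k[Δ f]`, with coefficients in `A`,
computed inside `ℤ[V]_d` as `A ⊗ (image of ℤ[V]_d ∩ ℤ[V]_λ in
ℤ[V]_d ⧸ (K_{f,d} + Σ_{i>j,l≥1} E_ij^(l) ℤ[V]_d))`. [cite: Humphreys1972, §27.1] -/
abbrev orbitHyperalgebraCoinvariants (f : MvPolynomial σ k) (m d : ℕ) (A : Type*) [CommRing A]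
    (μ : σ → ℤ) : Type _ :=
  (coordKostantModuleDeg σ ℤ m d).presentedHyperalgebraCoinvariants (orbitLatticeKerDeg f m d) A μ

/-- **`d_p(f; d, λ)`** (`orbitTorsionRank f m d p λ`): the `𝔽_p`-dimension of
`𝔽_p ⊗_ℤ Coinv(Λ_{f,d})_λ`, the weight-`λ` lowering coinvariants of the degree-`d` integral
lattice of the coordinate ring of the orbit closure of the degree-`m` form `f` — the number of
weight-`λ` generators of `Λ_{f,d} ⊗ 𝔽_p` over the hyperalgebra Borel, `=` (multiplicity in
`k[Δ f]_d` of the highest weight `λ`) `+` (number of `p`-torsion cyclic factors of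
`Coinv(Λ_{f,d})_λ`). Only weights `λ ≤ 0` with `Σ λ_i = -m·d` occur in degree `d` (others
give `0`). `p` prime (`p = 0`: the free rank `d_0`; `p = 1`: junk `0`).
[cite: Humphreys1972, §27.1] -/
def orbitTorsionRank (f : MvPolynomial σ k) (m d p : ℕ) (μ : σ → ℤ) : ℕ :=
  (coordKostantModuleDeg σ ℤ m d).presentedTorsionRank (orbitLatticeKerDeg f m d) p μ

end TorsionRank

/-! ### Matrix-shaped variables: the row-major Borel -/

section Matrix

/-- The row-major (= lexicographic) linear order on matrix positions `Fin m × Fin n`,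
`(i, j) ↦ n·i + j` (`finProdFinEquiv`), used to fix the Borel subgroup of `GL_{m·n}` when the
variables are matrix entries. A `def`, not an instance (Mathlib equips products with the
componentwise PARTIAL order); its `DecidableEq` is the product's own. [folklore] -/
abbrev rowMajorLinearOrder (m n : ℕ) : LinearOrder (Fin m × Fin n) :=
  { PartialOrder.lift (finProdFinEquiv : Fin m × Fin n ≃ Fin (m * n)) finProdFinEquiv.injective with
    le_total := fun a b => le_total (finProdFinEquiv a) (finProdFinEquiv b)
    toDecidableLE := fun a b =>
      inferInstanceAs (Decidable ((finProdFinEquiv a : Fin (m * n)) ≤ finProdFinEquiv b))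
    toDecidableEq := inferInstance
    toDecidableLT := fun a b =>
      inferInstanceAs (Decidable ((finProdFinEquiv a : Fin (m * n)) < finProdFinEquiv b))
    min := fun a b => if (finProdFinEquiv a : Fin (m * n)) ≤ finProdFinEquiv b then a else b
    max := fun a b => if (finProdFinEquiv a : Fin (m * n)) ≤ finProdFinEquiv b then b else a
    min_def := fun _ _ => rfl
    max_def := fun _ _ => rfl
    compare := fun a b =>
      if (finProdFinEquiv a : Fin (m * n)) < finProdFinEquiv b then Ordering.lt
      else if a = b then Ordering.eq else Ordering.gt
    compare_eq_compareOfLessAndEq := fun _ _ => rfl }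

variable {k : Type*} [Field k]

/-- `d_p(f; d, λ)` for a form `f` in matrix-entry variables `Fin m × Fin m` (e.g. `det_m`,
`X₀₀^{m-n} per_n`, of degree `deg = m`), with the Borel of `GL_{m²}` fixed by the row-major
order of the entries. [cite: Humphreys1972, §27.1] -/
def matrixOrbitTorsionRank {m : ℕ} (f : MvPolynomial (Fin m × Fin m) k) (deg d p : ℕ)
    (μ : Fin m × Fin m → ℤ) : ℕ :=
  @orbitTorsionRank (Fin m × Fin m) _ (rowMajorLinearOrder m m) k _ f deg d p μ

end Matrix

end Literature.RepresentationTheory.GeneralLinear
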